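import Summits.QuantumFields.YangMills.Theorems.FluctuationComparisonRegPrIntLS2BetaSqrtGaugeFillingTubeSection
import HarnessLib

/-!
# S2β · D-GUARD ∕ (BG∞) — FILL₂ DISCHARGED: THE STAGE-T FILLING LETTER OF `hSec_of_fillings` ((F2) part 2∕2): for every input scale `E` there are a universal
# output scale `A(E)` and threshold `ρ₀ := 2` such that on every box (sides `n κ ∈ [ρ, (4ρ+3)∕3]`) a datum `ε`-slow on the `(α, β)`-tube (`ερ ≤ E`) extends to a
# section equal to it on the tube and `(A∕ρ)`-slow on every bond — px19 g25's letter `h₂`, VERBATIM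

Cell `ym3-torus` (YM ladder rung R3 = continuum `SU(2)` Yang–Mills on the three-torus at fixed lattice data — a RUNG: NOT d = 4, NOT infinite volume,
NOT a mass gap, NOT Clay).  Width seat «width 5» `ym3-torus-px5` (gen 24), FREE px helper on crux `stmt-QuantumFields-20520` (`FluctuationComparisonRegPrIntL`;
registry `Lines/semiclassical_s2beta.lean` UNTOUCHED, 0∕5); `--kind proof --supports stmt-QuantumFields-20520 --as helper`, count-neutral, DEFINITION-FREE
(0 `def`, 0 `instance`, 0 `notation`, 0 `sorry`, default heartbeats).

WHY.  `hBG ⟸ hSec` (✓p840037) `⟸ FILL₁ ∧ FILL₂ ∧ FILL₃` (px19's `hSec_of_fillings`); FILL₂ is the universally quantified Stage-T letter.  The geometry is ✓(F2a)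
`tube_section`; here the NUMBERS are fixed once: `E′ := max E 0 + 1`, cap radius `r := 1∕(10⁴·E′²)` (absolute in `ρ`), `Λ ≤ π²∕(2r)` by Jordan's inequality
(`Real.mul_le_sin`), subsampling step `m := ⌊r·ρ∕(2π·E′)⌋₊ + 1` (so `(π∕2)·2(m−1)·ε ≤ r∕2` and `ρ∕m ≤ 2πE′∕r`, whence the packing count `≤ 4(4πE′∕r + 1)²` and
`hcard` by `π ∈ [2, 4]`), output scale `A := 13·(π²∕(2r))·E′ + 6π`; `α ↔ β` are swapped when `n α < n β` (the letter is symmetric); off the slow premise `W := ψ`.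

WHAT IS PROVED (sorry-free): §1 numerics (`Lambda_le`, `rad_le`, `count_le`, `card_lt_one`, `stepBound_le`, `side_lt`); §2 ★★★ `fill_tube` — the letter `h₂` of
`hSec_of_fillings`, BYTE FOR BYTE (∀ E ∃ A ρ₀ ∀ P (d = 3) ρ ≥ ρ₀, 8ρ ≤ N, ∀ n s (ρ ≤ n κ ∧ 3 n κ ≤ 4ρ+3) ∀ α β ψ ε, ∃ W, (ring agreement on the tube) ∧ (slow premise →
every bond of the box `≤ A∕ρ`)).

HONEST SCOPE.  Elementary real arithmetic + the composition of ✓(F2a); nothing of Bałaban's renormalisation-group analysis is asserted or proved ([Balaban1985RegularSpaces]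
Lemma 1 p.79, Thm 2 p.83 — local small gauges).  With FILL₂ landed, `hSec` still waits for FILL₁ and FILL₃ (other seats); `hSec` ∕ (BG∞) ∕ `hsupp⁺` remain HYPOTHESES
of ✓p840037 until then; GAP♯∘ (registry UNTOUCHED), the five registered stubs (0∕5), S2β, 20520, 19936, 19200, `YM3TorusSU2` are NOT proved; no registered stub is
closed; rung R3 — NOT d = 4, NOT infinite volume, NOT a mass gap, NOT Clay; the Yang–Mills mass gap is NOT proved.  Axioms standard.

References: T. Bałaban, CMP **99** (1985) 75–102 [Balaban1985RegularSpaces] (Lemma 1 p.79, Thm 2 p.83).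
-/

set_option autoImplicit false

noncomputable section

namespace Summit.QuantumFields.YangMills.Theorems.FluctuationComparisonRegPrIntLS2BetaSqrtGaugeFillingTube

open scoped Real
open Literature.MathematicalPhysics.QuantumLattice (su2Quat)
open Literature.MathematicalPhysics.QuantumFieldTheory.Balaban1983to89
open T4CubeChartGnomonic (SU2)
open T4ExpWindowSmallField (logVec)
open Summit.QuantumFields.YangMills.Theorems.FluctuationComparisonRegPrIntLS2BetaSqrtGaugeFillingTubeSection (tube_section)

/-! ## §1 Numerics -/

/-- **Jordan**: for `0 < r ≤ π∕2`, `Λ = (π − r)∕sin r ≤ π²∕(2r)`. [folklore] -/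
theorem Lambda_le {r : ℝ} (hr : 0 < r) (hr2 : r ≤ π / 2) : (π - r) / Real.sin r ≤ π ^ 2 / (2 * r) := by
  have hπ := Real.pi_pos
  have hsin : 2 / π * r ≤ Real.sin r := Real.mul_le_sin hr.le hr2
  have hpos : 0 < 2 / π * r := by positivity
  calc (π - r) / Real.sin r ≤ π / (2 / π * r) := div_le_div₀ hπ.le (by linarith) hpos hsin
    _ = π ^ 2 / (2 * r) := by field_simp

/-- **The patch radius**: with `m − 1 = ⌊r·ρ∕(2π·E′)⌋₊`, `ε ≥ 0`, `ε·ρ ≤ E ≤ E′`, `E′ > 0`: `(π∕2)·(2(m−1))·ε ≤ r∕2`. [folklore] -/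
theorem rad_le {r E E' ε : ℝ} {ρ : ℕ} (hr : 0 ≤ r) (hE' : 0 < E') (hEE' : E ≤ E') (hε : 0 ≤ ε) (hεE : ε * ρ ≤ E) :
    π / 2 * (((2 * ((⌊r * ρ / (2 * π * E')⌋₊ + 1) - 1) : ℕ) : ℝ) * ε) ≤ r / 2 := by
  have hπ := Real.pi_pos
  have hx0 : 0 ≤ r * ρ / (2 * π * E') := by positivity
  have hfl : ((⌊r * ρ / (2 * π * E')⌋₊ : ℕ) : ℝ) ≤ r * ρ / (2 * π * E') := Nat.floor_le hx0
  rw [Nat.add_sub_cancel]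
  push_cast
  have h1 : π / 2 * (2 * (⌊r * ρ / (2 * π * E')⌋₊ : ℝ) * ε) ≤ π / 2 * (2 * (r * ρ / (2 * π * E')) * ε) := by
    apply mul_le_mul_of_nonneg_left _ (by positivity)
    exact mul_le_mul_of_nonneg_right (by linarith) hε
  refine h1.trans ?_
  rw [show π / 2 * (2 * (r * ρ / (2 * π * E')) * ε) = r / 2 * ((ε * ρ) / E') by field_simp]
  have h2 : (ε * ρ) / E' ≤ 1 := by rw [div_le_one hE']; linarith
  calc r / 2 * ((ε * ρ) / E') ≤ r / 2 * 1 := mul_le_mul_of_nonneg_left h2 (by positivity)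
    _ = r / 2 := mul_one _

/-- **The face count**: for `nκ ≤ 2ρ` and `m = ⌊r·ρ∕(2π·E′)⌋₊ + 1` (`r, E′ > 0`): `(nκ∕m + 1 : ℕ) ≤ 4πE′∕r + 1`. [folklore] -/
theorem count_le {r E' : ℝ} {ρ nκ : ℕ} (hr : 0 < r) (hE' : 0 < E') (hn : nκ ≤ 2 * ρ) :
    (((nκ / (⌊r * ρ / (2 * π * E')⌋₊ + 1) + 1 : ℕ)) : ℝ) ≤ 4 * π * E' / r + 1 := by
  have hπ := Real.pi_pos
  set m : ℕ := ⌊r * ρ / (2 * π * E')⌋₊ + 1 with hm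
  have hm0 : (0 : ℝ) < m := by rw [hm]; positivity
  have hmx : r * ρ / (2 * π * E') ≤ (m : ℝ) := by
    rw [hm]; push_cast; exact (Nat.lt_floor_add_one _).le
  push_cast
  refine add_le_add ?_ le_rfl
  calc ((nκ / m : ℕ) : ℝ) ≤ (nκ : ℝ) / m := Nat.cast_div_le
    _ ≤ (2 * ρ : ℝ) / m := div_le_div_of_nonneg_right (by exact_mod_cast hn) hm0.le
    _ ≤ 4 * π * E' / r := by
        rw [div_le_div_iff₀ hm0 hr]
        have h := mul_le_mul_of_nonneg_left hmx (show (0 : ℝ) ≤ 2 * (2 * π * E') by positivity)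
        rw [show 2 * (2 * π * E') * (r * ρ / (2 * π * E')) = 2 * ρ * r by field_simp] at h
        calc (2 * ρ : ℝ) * r ≤ 2 * (2 * π * E') * m := h
          _ = 4 * π * E' * m := by ring

/-- **The packing count is below one** at `r := 1∕(10⁴·E′²)` (`E′ ≥ 1`): `(2·D·D + 2·D·D)·(2∕(3π))·(3r∕2)³ < 1` for any face counts `≤ D := 4πE′∕r + 1`. [folklore] -/
theorem card_lt_one {E' : ℝ} (hE' : 1 ≤ E') {a b c : ℝ} (ha0 : 0 ≤ a) (hc0 : 0 ≤ c)
    (ha : a ≤ 4 * π * E' / (1 / (10 ^ 4 * E' ^ 2)) + 1) (hb : b ≤ 4 * π * E' / (1 / (10 ^ 4 * E' ^ 2)) + 1)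
    (hc : c ≤ 4 * π * E' / (1 / (10 ^ 4 * E' ^ 2)) + 1) :
    (2 * (b * c) + 2 * (a * c)) * (2 / (3 * π) * (3 * (1 / (10 ^ 4 * E' ^ 2)) / 2) ^ 3) < 1 := by
  have hπ := Real.pi_pos
  have hπ4 := Real.pi_le_four
  have hπ2 := Real.two_le_pi
  set D : ℝ := 4 * π * E' / (1 / (10 ^ 4 * E' ^ 2)) + 1 with hD
  have hD' : D = 4 * π * 10 ^ 4 * E' ^ 3 + 1 := by rw [hD, div_div_eq_mul_div, div_one]; ring
  have hE3 : 1 ≤ E' ^ 3 := one_le_pow₀ hE'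
  have hDle : D ≤ 160001 * E' ^ 3 := by rw [hD']; nlinarith
  have hD0 : 0 ≤ D := by rw [hD']; positivity
  have hsum : 2 * (b * c) + 2 * (a * c) ≤ 4 * D ^ 2 := by nlinarith [mul_le_mul hb hc hc0 hD0, mul_le_mul ha hc hc0 hD0]
  have hE0 : 0 < E' := by linarith
  have hcoef : 2 / (3 * π) * (3 * (1 / (10 ^ 4 * E' ^ 2)) / 2) ^ 3 = (9 / (4 * π)) * (1 / (10 ^ 12 * E' ^ 6)) := by
    field_simp
    ring
  rw [hcoef]
  have hE6 : 0 < E' ^ 6 := by positivity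
  have hfin : 4 * (160001 * E' ^ 3) ^ 2 * (9 / (4 * π) * (1 / (10 ^ 12 * E' ^ 6))) = (160001 ^ 2 * 9 / 10 ^ 12) * (1 / π) := by
    field_simp
  calc (2 * (b * c) + 2 * (a * c)) * (9 / (4 * π) * (1 / (10 ^ 12 * E' ^ 6)))
      ≤ 4 * D ^ 2 * (9 / (4 * π) * (1 / (10 ^ 12 * E' ^ 6))) := mul_le_mul_of_nonneg_right hsum (by positivity)
    _ ≤ 4 * (160001 * E' ^ 3) ^ 2 * (9 / (4 * π) * (1 / (10 ^ 12 * E' ^ 6))) :=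
        mul_le_mul_of_nonneg_right (mul_le_mul_of_nonneg_left (pow_le_pow_left₀ hD0 hDle 2) (by norm_num)) (by positivity)
    _ = (160001 ^ 2 * 9 / 10 ^ 12) * (1 / π) := hfin
    _ ≤ (160001 ^ 2 * 9 / 10 ^ 12) * (1 / 2) := by
        apply mul_le_mul_of_nonneg_left _ (by norm_num)
        exact one_div_le_one_div_of_le (by norm_num) hπ2
    _ < 1 := by norm_num

/-- **The step bound**: `12Λε + 6(π−r)∕nκ ≤ A∕ρ` and `Λε ≤ A∕ρ` with `A := 13·Λ₀·E′ + 6π`, `Λ ≤ Λ₀`, `ε·ρ ≤ E ≤ E′`, `ρ ≤ nκ`. [folklore] -/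
theorem stepBound_le {Λ Λ₀ E E' ε r : ℝ} {ρ nκ : ℕ} (hΛ0 : 0 ≤ Λ) (hΛ : Λ ≤ Λ₀) (hE' : 0 ≤ E') (hEE' : E ≤ E') (hε : 0 ≤ ε) (hεE : ε * ρ ≤ E)
    (hr0 : 0 ≤ r) (hrπ : r ≤ π) (hρ : 1 ≤ ρ) (hn : ρ ≤ nκ) :
    12 * Λ * ε + 6 * (π - r) / nκ ≤ (13 * Λ₀ * E' + 6 * π) / ρ ∧ Λ * ε ≤ (13 * Λ₀ * E' + 6 * π) / ρ := by
  have hπ := Real.pi_pos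
  have hρ0 : (0 : ℝ) < ρ := by exact_mod_cast (show 0 < ρ by omega)
  have hn0 : (0 : ℝ) < nκ := by exact_mod_cast (show 0 < nκ by omega)
  have hρn : (ρ : ℝ) ≤ nκ := by exact_mod_cast hn
  have hΛ₀0 : 0 ≤ Λ₀ := hΛ0.trans hΛ
  -- `Λ ε ρ ≤ Λ₀ E′`
  have hΛε : Λ * ε * ρ ≤ Λ₀ * E' := by
    calc Λ * ε * ρ = Λ * (ε * ρ) := by ring
      _ ≤ Λ₀ * E' := mul_le_mul hΛ (hεE.trans hEE') (by positivity) hΛ₀0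
  constructor
  · rw [le_div_iff₀ hρ0]
    have h6 : 6 * (π - r) / nκ * ρ ≤ 6 * π := by
      rw [div_mul_eq_mul_div, div_le_iff₀ hn0]
      nlinarith
    nlinarith
  · rw [le_div_iff₀ hρ0]
    nlinarith

/-- **No wrap**: `3·nκ ≤ 4ρ + 3`, `8ρ ≤ N`, `1 ≤ ρ` give `nκ + 1 < N`. [folklore] -/
theorem side_lt {nκ ρ N : ℕ} (hn : 3 * nκ ≤ 4 * ρ + 3) (hN : 8 * ρ ≤ N) (hρ : 1 ≤ ρ) : nκ + 1 < N := by omega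


/-! ## §2 FILL₂ discharged -/

/-- ★★★ **FILL₂ — THE STAGE-T FILLING LETTER OF `hSec_of_fillings`, DISCHARGED** (px19 g25's `h₂`, byte for byte): for every `E` there are `A` and `ρ₀ := 2` such
that on every box of sides `n κ ∈ [ρ, (4ρ+3)∕3]`, `ρ ≥ ρ₀`, `8ρ ≤ N`, every datum `ψ` admits `W` equal to `ψ` on the `(α, β)`-tube of the box and, whenever `α ≠ β`
and the tube bonds of `ψ` are `ε`-slow with `ερ ≤ E`, `(A∕ρ)`-slow on every bond of the box (✓`tube_section` with `r := 1∕(10⁴·E′²)`, `E′ := max E 0 + 1`,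
`m := ⌊rρ∕(2πE′)⌋₊ + 1`, `A := 13·(π²∕(2r))·E′ + 6π`; `α ↔ β` by symmetry; `W := ψ` off the slow premise). [cite: Balaban1985RegularSpaces, Thm 2 p.83] -/
theorem fill_tube : ∀ E : ℝ, ∃ A : ℝ, ∃ ρ₀ : ℕ, ∀ (P : Params), P.d = 3 → ∀ ρ : ℕ, ρ₀ ≤ ρ → 8 * ρ ≤ P.sitesPerDir 0 →
      ∀ (n s : Fin P.d → ℕ), (∀ κ, ρ ≤ n κ ∧ 3 * n κ ≤ 4 * ρ + 3) →
      ∀ (α β : Fin P.d) (ψ : Site P 0 → SU2) (ε : ℝ), ∃ W : Site P 0 → SU2,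
        (∀ x : Site P 0, (∀ κ, (x κ - ((s κ : ℕ) : ZMod (P.sitesPerDir 0))).val ≤ n κ) →
          (((x α - ((s α : ℕ) : ZMod (P.sitesPerDir 0))).val = 0 ∨ (x α - ((s α : ℕ) : ZMod (P.sitesPerDir 0))).val = n α) ∨
            ((x β - ((s β : ℕ) : ZMod (P.sitesPerDir 0))).val = 0 ∨ (x β - ((s β : ℕ) : ZMod (P.sitesPerDir 0))).val = n β)) → W x = ψ x) ∧
        ((α ≠ β ∧ 0 ≤ ε ∧ ε * ρ ≤ E ∧ ∀ b : PBond P 0, (∀ κ, (b.src κ - ((s κ : ℕ) : ZMod (P.sitesPerDir 0))).val ≤ n κ) →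
            (∀ κ, (b.tgt κ - ((s κ : ℕ) : ZMod (P.sitesPerDir 0))).val ≤ n κ) →
            (((b.src α - ((s α : ℕ) : ZMod (P.sitesPerDir 0))).val = 0 ∨ (b.src α - ((s α : ℕ) : ZMod (P.sitesPerDir 0))).val = n α) ∨
              ((b.src β - ((s β : ℕ) : ZMod (P.sitesPerDir 0))).val = 0 ∨ (b.src β - ((s β : ℕ) : ZMod (P.sitesPerDir 0))).val = n β)) →
            (((b.tgt α - ((s α : ℕ) : ZMod (P.sitesPerDir 0))).val = 0 ∨ (b.tgt α - ((s α : ℕ) : ZMod (P.sitesPerDir 0))).val = n α) ∨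
              ((b.tgt β - ((s β : ℕ) : ZMod (P.sitesPerDir 0))).val = 0 ∨ (b.tgt β - ((s β : ℕ) : ZMod (P.sitesPerDir 0))).val = n β)) →
            dist1 (ψ b.src * (ψ b.tgt)⁻¹) ≤ ε) →
          ∀ b : PBond P 0, (∀ κ, (b.src κ - ((s κ : ℕ) : ZMod (P.sitesPerDir 0))).val ≤ n κ) →
            (∀ κ, (b.tgt κ - ((s κ : ℕ) : ZMod (P.sitesPerDir 0))).val ≤ n κ) →
            dist1 (W b.src * (W b.tgt)⁻¹) ≤ A / ρ) := by
  intro E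
  obtain ⟨E', hE'def⟩ : ∃ E' : ℝ, E' = max E 0 + 1 := ⟨_, rfl⟩
  have hE'1 : 1 ≤ E' := by rw [hE'def]; linarith [le_max_right E 0]
  have hE'0 : 0 < E' := by linarith
  have hEE' : E ≤ E' := by rw [hE'def]; linarith [le_max_left E 0]
  have hπ := Real.pi_pos
  have hπ2 := Real.two_le_pi
  obtain ⟨r, hrdef⟩ : ∃ r : ℝ, r = 1 / (10 ^ 4 * E' ^ 2) := ⟨_, rfl⟩
  have hr : 0 < r := by rw [hrdef]; positivity
  have hr1 : r ≤ 1 := by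
    rw [hrdef, div_le_one (by positivity)]
    nlinarith
  have hrπ : 3 * r / 2 ≤ π := by linarith
  have hr2 : r ≤ π / 2 := by linarith
  have hrπ' : r ≤ π := by linarith
  have hΛ : (π - r) / Real.sin r ≤ π ^ 2 / (2 * r) := Lambda_le hr hr2
  have hΛ0 : 0 ≤ (π - r) / Real.sin r := div_nonneg (by linarith) (Real.sin_nonneg_of_nonneg_of_le_pi hr.le hrπ')
  refine ⟨13 * (π ^ 2 / (2 * r)) * E' + 6 * π, 2, ?_⟩
  intro P hd ρ hρ2 hρN n s hn α β ψ ε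
  by_cases hslow : (α ≠ β ∧ 0 ≤ ε ∧ ε * ρ ≤ E ∧ ∀ b : PBond P 0, (∀ κ, (b.src κ - ((s κ : ℕ) : ZMod (P.sitesPerDir 0))).val ≤ n κ) →
            (∀ κ, (b.tgt κ - ((s κ : ℕ) : ZMod (P.sitesPerDir 0))).val ≤ n κ) →
            (((b.src α - ((s α : ℕ) : ZMod (P.sitesPerDir 0))).val = 0 ∨ (b.src α - ((s α : ℕ) : ZMod (P.sitesPerDir 0))).val = n α) ∨
              ((b.src β - ((s β : ℕ) : ZMod (P.sitesPerDir 0))).val = 0 ∨ (b.src β - ((s β : ℕ) : ZMod (P.sitesPerDir 0))).val = n β)) →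
            (((b.tgt α - ((s α : ℕ) : ZMod (P.sitesPerDir 0))).val = 0 ∨ (b.tgt α - ((s α : ℕ) : ZMod (P.sitesPerDir 0))).val = n α) ∨
              ((b.tgt β - ((s β : ℕ) : ZMod (P.sitesPerDir 0))).val = 0 ∨ (b.tgt β - ((s β : ℕ) : ZMod (P.sitesPerDir 0))).val = n β)) →
            dist1 (ψ b.src * (ψ b.tgt)⁻¹) ≤ ε)
  swap
  · exact ⟨ψ, fun _ _ _ => rfl, fun h => absurd h hslow⟩
  obtain ⟨hαβ, hε, hεE, hlet⟩ := hslow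
  have hρ1 : 1 ≤ ρ := by omega
  have hN : ∀ κ, n κ + 1 < P.sitesPerDir 0 := fun κ => side_lt (hn κ).2 hρN hρ1
  have hn2 : ∀ κ, n κ ≤ 2 * ρ := fun κ => by have := (hn κ).2; omega
  have hrad := rad_le (ρ := ρ) hr.le hE'0 hEE' hε hεE (r := r)
  have hB : ∀ κ0 : Fin P.d, 12 * ((π - r) / Real.sin r) * ε + 6 * (π - r) / (n κ0) ≤ (13 * (π ^ 2 / (2 * r)) * E' + 6 * π) / ρ ∧
      ((π - r) / Real.sin r) * ε ≤ (13 * (π ^ 2 / (2 * r)) * E' + 6 * π) / ρ :=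
    fun κ0 => stepBound_le hΛ0 hΛ hE'0.le hEE' hε hεE hr.le hrπ' hρ1 (hn κ0).1
  have hcardAll : ∀ κ1 κ2 : Fin P.d, ∀ nγ : ℕ, (∃ κ, nγ = n κ) →
      ((2 * ((n κ1 / (⌊r * ρ / (2 * π * E')⌋₊ + 1) + 1) * (nγ / (⌊r * ρ / (2 * π * E')⌋₊ + 1) + 1)) +
        2 * ((n κ2 / (⌊r * ρ / (2 * π * E')⌋₊ + 1) + 1) * (nγ / (⌊r * ρ / (2 * π * E')⌋₊ + 1) + 1)) : ℕ) : ℝ) *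
        (2 / (3 * π) * (3 * r / 2) ^ 3) < 1 := by
    intro κ1 κ2 nγ ⟨κ, hκ⟩
    have hD1 : (((n κ1 / (⌊r * ρ / (2 * π * E')⌋₊ + 1) : ℕ) : ℝ) + 1) ≤ 4 * π * E' / r + 1 := by
      exact_mod_cast count_le (ρ := ρ) (nκ := n κ1) hr hE'0 (hn2 κ1)
    have hD2 : (((n κ2 / (⌊r * ρ / (2 * π * E')⌋₊ + 1) : ℕ) : ℝ) + 1) ≤ 4 * π * E' / r + 1 := by
      exact_mod_cast count_le (ρ := ρ) (nκ := n κ2) hr hE'0 (hn2 κ2)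
    have hD3 : (((nγ / (⌊r * ρ / (2 * π * E')⌋₊ + 1) : ℕ) : ℝ) + 1) ≤ 4 * π * E' / r + 1 := by
      exact_mod_cast count_le (ρ := ρ) (nκ := nγ) hr hE'0 (by rw [hκ]; exact hn2 κ)
    rw [hrdef] at hD1 hD2 hD3 ⊢
    push_cast
    exact card_lt_one hE'1 (by positivity) (by positivity) hD2 hD1 hD3
  by_cases hle : n β ≤ n α
  · obtain ⟨W, hi, hb⟩ := tube_section hd n s hN hαβ (by have := (hn β).1; omega) hle
      (by have := (hn α).2; have := (hn β).1; omega) ψ hε hr hrπ (⌊r * ρ / (2 * π * E')⌋₊ + 1) (by omega) hrad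
      (hcardAll β α) (hB α).1 (hB α).2 hlet
    exact ⟨W, hi, fun _ => hb⟩
  · have hle' : n α ≤ n β := by omega
    obtain ⟨W, hi, hb⟩ := tube_section hd n s hN (Ne.symm hαβ) (by have := (hn α).1; omega) hle'
      (by have := (hn β).2; have := (hn α).1; omega) ψ hε hr hrπ (⌊r * ρ / (2 * π * E')⌋₊ + 1) (by omega) hrad
      (hcardAll α β) (hB β).1 (hB β).2 (fun b h1 h2 h3 h4 => hlet b h1 h2 h3.symm h4.symm)
    exact ⟨W, fun x hx ht => hi x hx ht.symm, fun _ => hb⟩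

end Summit.QuantumFields.YangMills.Theorems.FluctuationComparisonRegPrIntLS2BetaSqrtGaugeFillingTube

end
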